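import Summits.HodgeConjecture.HodgeConjecture.Theses.EndoscopicMiddleDegree
import Literature.AlgebraicGeometry.ShimuraVarieties.HeckeCorrespondenceAction
import Literature.AlgebraicGeometry.HodgeTheory.ComplexGysinCorrespondence
import Literature.AlgebraicGeometry.HodgeTheory.ComplexConjugationHolds
import Literature.AlgebraicGeometry.HodgeTheory.ComplexGysinHodgeType
import Literature.AlgebraicGeometry.HodgeTheory.HodgeTypePullback
import Literature.AlgebraicGeometry.HodgeTheory.HodgeFiltrationModelsReductionProofs
import Literature.AlgebraicGeometry.HodgeTheory.SupportedClassesHodgeConiveau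
import Literature.NumberTheory.Transcendental.DeRhamTheoremMultiplicative

/-!
# Hecke operators preserve Hodge types, from the algebraicity of the Hecke graphs and Grothendieck's
# coniveau inclusion (crux `EndoscopicMiddleDegree.OrthogonalEnveloped`, stmt-HodgeConjecture-14300;
# `--supports`; third lead lineage, seat c2, 2026-08-16)

The line `purity-sorted-hecke-envelope` uses its construction stub `stub_heckePushPull` (a SCHEME structure
on the Hecke level covers) twice: (1) to make every Hecke operator `T_g` the action of an ALGEBRAIC class
on `X ⊗ X` (`heckeGraphAlgebraic`), and (2) to show that the Hecke algebra preserves Hodge types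
(`heckeHodgeType`, via pull-back and Gysin of scheme morphisms). The companion file
`…HeckeGraphChow` delivers (1) from pure topology + the analyticity of the Hecke graph (Chow + GAGA, proved
in the tree). This file delivers (2) FROM (1): the action of ANY algebraic self-correspondence of `X`
preserves every Hodge type, GRANTED the named fact `Grothendieck1969_supportedClasses_le_hodgeConiveau`
(Deligne, Hodge II: `Nˢ H²ˢ ⊆` Hodge coniveau `≥ s`; in degree `2s` that is `H^{s,s}`), by the tree's proved
Hodge-type calculus: `pr₂^*` has bidegree `(0,0)` (`IsOfHodgeType.map_of_independent`), `∪ γ` bidegree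
`(n,n)` (`cupPreservesHodgeType_of_nonempty_hodgeModel`, de Rham's theorem in multiplicative form), `pr₁₊`
bidegree `(-n,-n)` (`isOfHodgeType_complexGysin`).

* `isOfHodgeType_of_mem_algebraicClasses_of_grothendieck`, `isOfHodgeType_corrAction_of_grothendieck`;
* `stub_heckeHodgeTypeOfGraphAlgebraic` (REGISTERED stub of the crux): (1) ∧ Grothendieck1969 ⟹ every
  `T_g` preserves every Hodge type `(p, q)` — the hypothesis `hH` of the landed `stub_killedBarren` at
  `(p,q) = (n,n)`, now a CONDITIONAL result on one published named fact instead of a construction.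

References: Grothendieck, Topology 8 (1969) pp. 299–300; Voisin I §7.3.2, §11.3.3; BMM arXiv:1306.1515 Thm. 61.
-/

noncomputable section

-- The mandated namespace `Summit.<P>.<Sub>.Theorems.…` repeats `HodgeConjecture` (single-conjunct summit).
set_option linter.dupNamespace false

namespace Summit.HodgeConjecture.HodgeConjecture.Theorems.EndoscopicMiddleDegreeOrthogonalEnvelopedHeckeGraphChowHodgeType

open scoped Manifold
open CategoryTheory MonoidalCategory CartesianMonoidalCategory
open Literature.AlgebraicGeometry.Motives (SchemeOver ComplexPoints IsSmoothProjective AlgPoints)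
open Literature.AlgebraicGeometry.Motives (IsSmoothProjective.tensor_holds)
open Literature.AlgebraicGeometry.HodgeTheory
open Literature.AlgebraicGeometry.ShimuraVarieties
open Literature.AlgebraicTopology.SingularHomology

variable {m : ℕ} {X : SchemeOver ℂ}

/-- **An algebraic class on `X ⊗ X` in degree `2·dim X` is of type `(dim X, dim X)`**, GRANTED
`Grothendieck1969_supportedClasses_le_hodgeConiveau` (`N^s H^{2s} ⊆` Hodge coniveau `≥ s`, and in degree
`2s` the only piece of coniveau `≥ s` is `H^{s,s}`). [cite: GrothendieckTopology1969, p. 299 (∗) and p. 300]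
[cite: VoisinHodgeI2002, §7.1.1] -/
theorem isOfHodgeType_of_mem_algebraicClasses_of_grothendieck
    (hG : Grothendieck1969_supportedClasses_le_hodgeConiveau) {n : ℕ} {Y : SchemeOver ℂ}
    (hY : IsSmoothProjective n Y) {s : ℕ} {γ : complexBetti Y (2 * s)}
    (hγ : γ ∈ algebraicClasses Y s) : IsOfHodgeType n Y (2 * s) s s γ := by
  obtain ⟨A⟩ := nonempty_hodgeModel_holds.nonempty hY
  refine ⟨A, ?_⟩
  have h := hG hY A (2 * s) s ⟨γ, hγ, rfl⟩
  refine (iSup_le fun p ↦ iSup_le fun q ↦ iSup_le fun hpq ↦ iSup_le fun hp ↦ iSup_le fun hq ↦ ?_ :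
    A.hodgeConiveau (2 * s) s ≤ A.hodgePQ (2 * s) s s) h
  obtain rfl : p = s := by omega
  obtain rfl : q = p := by omega
  exact le_rfl

/-- **The action of an ALGEBRAIC self-correspondence preserves every Hodge type**, GRANTED
`Grothendieck1969_supportedClasses_le_hodgeConiveau`: `P_γ β = pr₁₊(pr₂^* β ∪ γ)` with `pr₂^*` of
bidegree `(0,0)` (`IsOfHodgeType.map_of_independent`), `∪ γ` of bidegree `(n,n)` for `γ` of type `(n,n)`
(`cupPreservesHodgeType_of_nonempty_hodgeModel`, de Rham's theorem in multiplicative form), and `pr₁₊` of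
bidegree `(-n,-n)` (`isOfHodgeType_complexGysin`), `n = dim X`. [cite: VoisinHodgeI2002, §7.3.2 (with Lemma 7.30) and §11.3.3]
[cite: GrothendieckTopology1969, p. 300] -/
theorem isOfHodgeType_corrAction_of_grothendieck
    (hG : Grothendieck1969_supportedClasses_le_hodgeConiveau) (μ : OrientationFamily)
    (hX : IsSmoothProjective (2 * (m + 1)) X) {γ : complexBetti (X ⊗ X) (2 * (2 * (m + 1)))}
    (hγ : γ ∈ algebraicClasses (X ⊗ X) (2 * (m + 1))) {p q : ℕ} {β : complexBetti X (2 * (m + 1))}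
    (hβ : IsOfHodgeType (2 * (m + 1)) X (2 * (m + 1)) p q β) :
    IsOfHodgeType (2 * (m + 1)) X (2 * (m + 1)) p q
      (corrAction μ hX hX
        (rfl : 2 * (m + 1) + 2 * (2 * (m + 1)) = 2 * (m + 1) + 2 * (2 * (m + 1))) γ β) := by
  have hY := IsSmoothProjective.tensor_holds hX hX
  have hI := hodgePQ_independent_of_hodgeModel_holds
  have hM : ∀ (k : ℕ) (Z : SchemeOver ℂ), nonempty_hodgeModel k Z := fun _ _ ↦ nonempty_hodgeModel_holds
  have hdR : ∀ (E : Type) [NormedAddCommGroup E] [NormedSpace ℂ E] [FiniteDimensional ℂ E],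
      Literature.NumberTheory.Transcendental.exists_deRhamIsoFamily 𝓘(ℝ, E) :=
    fun E _ _ _ ↦ Literature.NumberTheory.Transcendental.exists_deRhamIsoFamily_holds (E := E)
  obtain ⟨B⟩ := nonempty_hodgeModel_holds.nonempty hY
  -- `pr₂^* β` is of type `(p, q)` and `γ` of type `(n, n)` on `X ⊗ X`
  have h2 : IsOfHodgeType (2 * (m + 1) + 2 * (m + 1)) (X ⊗ X) (2 * (m + 1)) p q
      (complexBetti.map (snd X X) (2 * (m + 1)) β) :=
    hβ.map_of_independent hI hY hX B (snd X X)
  have hγt : IsOfHodgeType (2 * (m + 1) + 2 * (m + 1)) (X ⊗ X) (2 * (2 * (m + 1)))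
      (2 * (m + 1)) (2 * (m + 1)) γ :=
    isOfHodgeType_of_mem_algebraicClasses_of_grothendieck hG hY hγ
  -- their cup product is of type `(p + n, q + n)`
  have hcup := cupPreservesHodgeType_of_nonempty_hodgeModel hI (hM _ _) hdR hY
    (rfl : 2 * (m + 1) + 2 * (2 * (m + 1)) = 2 * (m + 1) + 2 * (2 * (m + 1))) h2 hγt
  -- and `pr₁₊` brings it back to type `(p, q)`
  rw [corrAction_apply]
  exact isOfHodgeType_complexGysin hI hM hdR μ hY hX (fst X X) _
    (p := p + 2 * (m + 1)) (q := q + 2 * (m + 1)) (by omega) (by omega) hcup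


/-- **REGISTERED STUB `stub_heckeHodgeTypeOfGraphAlgebraic` of the crux (seat c2): if every Hecke operator
is the action of an algebraic self-correspondence (the conclusion `heckeGraphAlgebraic` of the lines, i.e.
of `…HeckeGraphChow.stub_heckeGraphAlgebraicOfInputs`) then, GRANTED
`Grothendieck1969_supportedClasses_le_hodgeConiveau`, every Hecke operator preserves every Hodge type.**
[cite: BergeronMillsonMoeglin2016Balls, Part 2 §1.8 and Thm. 61] [cite: GrothendieckTopology1969, p. 300] -/
theorem stub_heckeHodgeTypeOfGraphAlgebraic :
    (∀ (μ : OrientationFamily), μ.HasPoincareDuality →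
      ∀ (m : ℕ) (X : SchemeOver ℂ) (D : UnitaryBallQuotientDatum (2 * (m + 1)) X), 1 ≤ m → m ≤ 2 →
        ∀ g : GL (Fin (2 * (m + 1) + 1)) D.E,
          ∃ γ ∈ algebraicClasses (X ⊗ X) (2 * (m + 1)),
            corrAction μ D.isSmoothProjective D.isSmoothProjective
                (rfl : 2 * (m + 1) + 2 * (2 * (m + 1)) = 2 * (m + 1) + 2 * (2 * (m + 1))) γ =
              D.heckeCorrespondenceAction (2 * (m + 1)) g) →
    Grothendieck1969_supportedClasses_le_hodgeConiveau →
    ∀ (μ : OrientationFamily), μ.HasPoincareDuality →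
      ∀ (m : ℕ) (X : SchemeOver ℂ) (D : UnitaryBallQuotientDatum (2 * (m + 1)) X), 1 ≤ m → m ≤ 2 →
        ∀ (g : GL (Fin (2 * (m + 1) + 1)) D.E) (p q : ℕ) (β : complexBetti X (2 * (m + 1))),
          IsOfHodgeType (2 * (m + 1)) X (2 * (m + 1)) p q β →
          IsOfHodgeType (2 * (m + 1)) X (2 * (m + 1)) p q (D.heckeCorrespondenceAction (2 * (m + 1)) g β) := by
  intro hGA hG μ hμ m X D hm1 hm2 g p q β hβ
  obtain ⟨γ, hγ, hP⟩ := hGA μ hμ m X D hm1 hm2 g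
  rw [← hP]
  exact isOfHodgeType_corrAction_of_grothendieck hG μ D.isSmoothProjective hγ hβ

end Summit.HodgeConjecture.HodgeConjecture.Theorems.EndoscopicMiddleDegreeOrthogonalEnvelopedHeckeGraphChowHodgeType

end
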